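import Literature.NumberTheory.Rogawski1990.ExplicitFactorRationalLocalisation
import Literature.NumberTheory.Rogawski1990.ExplicitFactorGlobalReciprocity
import Literature.NumberTheory.Rogawski1990.GRegularLocalisation
import Literature.NumberTheory.Rogawski1990.FinExplicitTransferFactorNondegenerate
import Literature.NumberTheory.Rogawski1990.GlobalTransferFactor
import HarnessLib

/-!
# A.e. triviality of Rogawski's explicit finite transfer factors, I: `τ_v(γ_H) = 1` and `D_{G∕H,v}(γ_H) = 1` for almost all `v`,
# and the reduction of N3 to «`κ_v = +1` for almost all `v`»
(Rogawski, *Automorphic Representations of Unitary Groups in Three Variables* (1990), §4.3 p. 44 («`Δ_{G_v∕H_v}(γ_H, γ̄_v) = 1` for almost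
all `v`»), §4.9 p. 55 (`τ`, `D_{G∕H}`), §14.6 p. 242 («`+1` for almost all `v`»); Tate, *Fourier analysis in number fields* (1967), §4.3)

Topic `NumberTheory/Rogawski1990`; namespace `Literature.NumberTheory.Rogawski1990`.  THEOREMS ONLY over accepted tree modules: no definition,
no named fact, no instance, no notation, no `sorry`.  Cell `pub/hodgecm-mathlib`, F0∕P3a, T6 node **N3** (`F0/P3a/T6b-TREE.md` §9; DESK TABLE #3
row (4)): the third clause «a.e. triviality» of the #72 letter ★ `GlobalTransferWithCartanKappaFormula` for the EXPLICIT finite collection ★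
`finExplicitCollection` (`Δ‴_v = τ_v · D_{G∕H,v} · κ_v` on matching pairs, ★ `finExplicitDelta_of_isLocalNormPair`), FILE A of three:

* §1 **`eventually_finTau_rationalComponent_eq_one`** — for a rational `G`-regular `γ_H`, `τ_v((γ_H)_v) = 1` for almost all `v`: `τ_v` is the
  quotient of the semi-local values of `μ` at the images of the GLOBAL units `u = γ₂` and `−χ_g(u)∕det g` of `L^×` (★ `finTau_rationalComponent`,
  F0P3a-p08 (g8)), each `= 1` for almost all `v` (★ `eventually_semilocalComponent_map_algebraMap_eq_one`, F0P3a-p05 (g8): `μ` unramified and the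
  unit a local unit almost everywhere); `χ_g(u) ≠ 0` is `G`-regularity (`eval_charpoly_gammaTwo_ne_zero_of_isGRegular`).
* §2 **`eventually_finWeylRatio_rationalComponent_eq_one`** — `D_{G∕H,v}((γ_H)_v) = √(∏_{w∣v} ‖χ_g(u)‖_w) = 1` for almost all `v` (★
  `finWeylRatio_rationalComponent` + ★ `eventually_prod_placesOver_norm_coe_eq_one`).
* §3 **`isAlmostEverywhereTrivial_finExplicitCollection_of_eventually_finKappaAt`** — N3 REDUCED TO ITS `κ`-PART: if for every rational `G`-regular
  `γ_H` and every adelic `γ̄` matching it everywhere `κ_v((γ_H)_v, γ̄_v) = 1` for almost all `v`, then ★ `IsAlmostEverywhereTrivial` holds for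
  `finExplicitCollection μ hl hr`.  The `κ`-part (hyperspecial integrality at the unramified non-split places, local kernel ★
  `Literature.LinearAlgebra.Matrix.RankOneHermitianColumnNorm`) is FILE C.

HONEST LABEL: HC_CM is proved only modulo the printed citations until rung 0 closes; this file proves no printed citation by itself.

## References
* J. D. Rogawski, *Automorphic Representations of Unitary Groups in Three Variables*, Ann. of Math. Stud. 123 (1990), §4.3 p. 44, §4.9 p. 55,
  §14.6 p. 242 [Rogawski1990].
* J. Tate, *Fourier analysis in number fields and Hecke's zeta-functions* (1967), §4.3 [TateThesis1967].
-/

set_option autoImplicit false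

noncomputable section

open NumberField IsDedekindDomain Filter Matrix Polynomial
open Literature.NumberTheory.GaloisRepresentations
open scoped Classical

namespace Literature.NumberTheory.Rogawski1990

open Literature.NumberTheory.Automorphic

variable (L : Type) [Field L] [NumberField L] [IsCMField L]

/-! ## §0 Global non-vanishing from `G`-regularity -/

section Global

variable (γH : (UnitaryGroup.cmDatum L 2 (Matrix.of fun i j : Fin 2 => if i.val + j.val + 1 = 2 then (1 : L) else 0)).Rational ×
    (UnitaryGroup.cmDatum L 1 (Matrix.of fun i j : Fin 1 => if i.val + j.val + 1 = 1 then (1 : L) else 0)).Rational)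

/-- `u = γ₂ ≠ 0` (the entry of a `1 × 1` invertible matrix is its determinant). [cite: Rogawski1990, §4.9 p. 55] -/
theorem gammaTwo_ne_zero : (γH.2.val.val : Matrix (Fin 1) (Fin 1) L) 0 0 ≠ 0 := by
  have h := (Matrix.GeneralLinearGroup.det (γH.2.val : GL (Fin 1) L)).ne_zero
  rwa [Matrix.GeneralLinearGroup.val_det_apply, Matrix.det_fin_one] at h

/-- `det g⁻¹ ≠ 0`. [cite: Rogawski1990, §4.9 p. 55] -/
theorem det_inv_fst_ne_zero : (((γH.1.val⁻¹).val : Matrix (Fin 2) (Fin 2) L)).det ≠ 0 := by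
  have h := (Matrix.GeneralLinearGroup.det ((γH.1.val : GL (Fin 2) L)⁻¹)).ne_zero
  rwa [Matrix.GeneralLinearGroup.val_det_apply] at h

/-- **`G`-regularity at a rational `γ_H` gives `χ_g(u) ≠ 0` in `L`**: at any finite place `v` the localisation `(γ_H)_v` is `G`-regular (★
`isLocalGRegular_rationalComponent`), so `χ_g(u) ⊗ 1` is a unit of `∏_{w∣v} L_w` (★ `isUnit_eval_finCharpolyTwo_of_isLocalGRegular`); it is the
image of the global `χ_g(u)` (★ `finCharpolyTwo_rationalComponent`, `finGammaTwo_rationalComponent`). [cite: Rogawski1990, §4.3 p. 42; §4.9 p. 55] -/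
theorem eval_charpoly_gammaTwo_ne_zero_of_isGRegular
    (hreg : IsGRegular (cmConjRingHom L) (Matrix.of fun i j : Fin 2 => if i.val + j.val + 1 = 2 then (1 : L) else 0)
      (Matrix.of fun i j : Fin 1 => if i.val + j.val + 1 = 1 then (1 : L) else 0)
      (Matrix.of fun i j : Fin 3 => if i.val + j.val + 1 = 3 then (1 : L) else 0) endoForm_antidiagOne γH) :
    ((γH.1.val.val : Matrix (Fin 2) (Fin 2) L).charpoly).eval ((γH.2.val.val : Matrix (Fin 1) (Fin 1) L) 0 0) ≠ 0 := by
  obtain ⟨v⟩ : Nonempty (HeightOneSpectrum (𝓞 ↥(maximalRealSubfield L))) := by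
    obtain ⟨𝔪, h𝔪⟩ := Ideal.exists_maximal (𝓞 ↥(maximalRealSubfield L))
    exact ⟨⟨𝔪, h𝔪.isPrime, Ring.ne_bot_of_isMaximal_of_not_isField h𝔪 (RingOfIntegers.not_isField ↥(maximalRealSubfield L))⟩⟩
  intro h0
  have hu := isUnit_eval_finCharpolyTwo_of_isLocalGRegular L v (rationalComponent L γH v) (isLocalGRegular_rationalComponent L γH hreg v)
  rw [finCharpolyTwo_rationalComponent, finGammaTwo_rationalComponent, Polynomial.eval_map, Polynomial.eval₂_hom, h0, map_zero] at hu
  haveI : Nontrivial (UnitaryGroup.LocalRing L v) := by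
    obtain ⟨w⟩ := (inferInstance : Nonempty (UnitaryGroup.PlacesOver L v))
    exact ⟨⟨0, 1, fun h => zero_ne_one (congrFun h w)⟩⟩
  exact not_isUnit_zero hu

end Global

/-! ## §1 `τ_v((γ_H)_v) = 1` for almost all `v` -/

section Tau

variable (γH : (UnitaryGroup.cmDatum L 2 (Matrix.of fun i j : Fin 2 => if i.val + j.val + 1 = 2 then (1 : L) else 0)).Rational ×
    (UnitaryGroup.cmDatum L 1 (Matrix.of fun i j : Fin 1 => if i.val + j.val + 1 = 1 then (1 : L) else 0)).Rational)

omit [IsCMField L] in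
/-- `μ_v` at the image of a global unit `k ∈ L^×` is the semi-local component of `μ` at `(k)_v` (★ `finHeckeValue_of_isUnit`). [cite: TateThesis1967, §4.3] -/
theorem finHeckeValue_algebraMap_units (μ : HeckeCharacter L) (v : HeightOneSpectrum (𝓞 ↥(maximalRealSubfield L))) (k : Lˣ) :
    finHeckeValue L v μ (algebraMap L (UnitaryGroup.LocalRing L v) (k : L)) =
      ((μ.semilocalComponent L v (Units.map (algebraMap L (UnitaryGroup.LocalRing L v) : L →* UnitaryGroup.LocalRing L v) k) : ℂˣ) : ℂ) := by
  have hx : IsUnit (algebraMap L (UnitaryGroup.LocalRing L v) (k : L)) :=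
    (Units.map (algebraMap L (UnitaryGroup.LocalRing L v) : L →* UnitaryGroup.LocalRing L v) k).isUnit
  rw [finHeckeValue_of_isUnit L v μ hx]
  congr 2
  exact Units.ext rfl

/-- **`τ_v((γ_H)_v) = 1` FOR ALMOST ALL `v`** (rational `G`-regular `γ_H`): the two Hecke values in `τ_v = μ_v(u) μ_v(−χ_g(u)∕det g)⁻¹` are semi-local
components of `μ` at the GLOBAL units `u`, `−χ_g(u)∕det g ∈ L^×`, both `1` for almost all `v`. [cite: Rogawski1990, §4.9 p. 55; §14.6 p. 242]
[cite: TateThesis1967, §4.3] -/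
theorem eventually_finTau_rationalComponent_eq_one (μ : HeckeCharacter L)
    (hreg : IsGRegular (cmConjRingHom L) (Matrix.of fun i j : Fin 2 => if i.val + j.val + 1 = 2 then (1 : L) else 0)
      (Matrix.of fun i j : Fin 1 => if i.val + j.val + 1 = 1 then (1 : L) else 0)
      (Matrix.of fun i j : Fin 3 => if i.val + j.val + 1 = 3 then (1 : L) else 0) endoForm_antidiagOne γH) :
    ∀ᶠ v : HeightOneSpectrum (𝓞 ↥(maximalRealSubfield L)) in cofinite, finTau L v (rationalComponent L γH v) μ = 1 := by
  set u : L := (γH.2.val.val : Matrix (Fin 1) (Fin 1) L) 0 0 with hu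
  set t : L := -(((γH.1.val.val : Matrix (Fin 2) (Fin 2) L).charpoly).eval u) * (((γH.1.val⁻¹).val : Matrix (Fin 2) (Fin 2) L)).det with ht
  have hu0 : u ≠ 0 := gammaTwo_ne_zero L γH
  have ht0 : t ≠ 0 :=
    mul_ne_zero (neg_ne_zero.2 (eval_charpoly_gammaTwo_ne_zero_of_isGRegular L γH hreg)) (det_inv_fst_ne_zero L γH)
  filter_upwards [eventually_semilocalComponent_map_algebraMap_eq_one (↥(maximalRealSubfield L)) μ (Units.mk0 u hu0),
    eventually_semilocalComponent_map_algebraMap_eq_one (↥(maximalRealSubfield L)) μ (Units.mk0 t ht0)] with v hv1 hv2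
  rw [finTau_rationalComponent]
  have h1 := finHeckeValue_algebraMap_units L μ v (Units.mk0 u hu0)
  have h2 := finHeckeValue_algebraMap_units L μ v (Units.mk0 t ht0)
  rw [Units.val_mk0] at h1 h2
  rw [← hu, ← ht, h1, h2, hv1, hv2, Units.val_one, inv_one, mul_one]

end Tau

/-! ## §2 `D_{G∕H,v}((γ_H)_v) = 1` for almost all `v` -/

section Weyl

variable (γH : (UnitaryGroup.cmDatum L 2 (Matrix.of fun i j : Fin 2 => if i.val + j.val + 1 = 2 then (1 : L) else 0)).Rational ×
    (UnitaryGroup.cmDatum L 1 (Matrix.of fun i j : Fin 1 => if i.val + j.val + 1 = 1 then (1 : L) else 0)).Rational)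

/-- **`D_{G∕H,v}((γ_H)_v) = 1` FOR ALMOST ALL `v`** (rational `G`-regular `γ_H`): `D_{G∕H,v} = √(∏_{w∣v} ‖χ_g(u)‖_w)` with the GLOBAL `χ_g(u) ∈ L^×`,
a `w`-adic unit for almost all `w`. [cite: Rogawski1990, §4.9 p. 55; §14.6 p. 242] -/
theorem eventually_finWeylRatio_rationalComponent_eq_one
    (hreg : IsGRegular (cmConjRingHom L) (Matrix.of fun i j : Fin 2 => if i.val + j.val + 1 = 2 then (1 : L) else 0)
      (Matrix.of fun i j : Fin 1 => if i.val + j.val + 1 = 1 then (1 : L) else 0)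
      (Matrix.of fun i j : Fin 3 => if i.val + j.val + 1 = 3 then (1 : L) else 0) endoForm_antidiagOne γH) :
    ∀ᶠ v : HeightOneSpectrum (𝓞 ↥(maximalRealSubfield L)) in cofinite, finWeylRatio L v (rationalComponent L γH v) = 1 := by
  have hk := eval_charpoly_gammaTwo_ne_zero_of_isGRegular L γH hreg
  filter_upwards [eventually_prod_placesOver_norm_coe_eq_one (↥(maximalRealSubfield L)) hk] with v hv
  rw [finWeylRatio_rationalComponent]
  have hv' : (∏ w : UnitaryGroup.PlacesOver L v,
      ‖algebraMap L (w.1.adicCompletion L) (((γH.1.val.val : Matrix (Fin 2) (Fin 2) L).charpoly).eval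
        ((γH.2.val.val : Matrix (Fin 1) (Fin 1) L) 0 0))‖) = 1 := hv
  rw [hv', Real.sqrt_one]

end Weyl

/-! ## §3 N3 reduced to its `κ`-part -/

section Reduction

variable (H' : Matrix (Fin 3) (Fin 3) L) (μ : HeckeCharacter L)

/-- **A.E. TRIVIALITY OF THE EXPLICIT FINITE COLLECTION, GIVEN «`κ_v = +1` FOR ALMOST ALL `v`»**: for every rational `G`-regular `γ_H` and every
adelic `γ̄ ∈ G′(𝔸)` matching `γ_H` at every finite place, IF `κ_v((γ_H)_v, γ̄_v) = 1` for almost all `v` THEN `Δ‴_v((γ_H)_v, γ̄_v) = 1` for almost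
all `v` (★ `finExplicitDelta_of_isLocalNormPair`: `Δ‴_v = τ_v · D_v · κ_v` on matching pairs; §1, §2).  The hypothesis is FILE C (hyperspecial
integrality, Kottwitz (1986) §7). [cite: Rogawski1990, §4.3 p. 44; §14.6 p. 242] -/
theorem isAlmostEverywhereTrivial_finExplicitCollection_of_eventually_finKappaAt
    (hl : ∀ (v : HeightOneSpectrum (𝓞 ↥(maximalRealSubfield L)))
      (a : (UnitaryGroup.cmDatum L 2 (Matrix.of fun i j : Fin 2 => if i.val + j.val + 1 = 2 then (1 : L) else 0)).Local v ×
      (UnitaryGroup.cmDatum L 1 (Matrix.of fun i j : Fin 1 => if i.val + j.val + 1 = 1 then (1 : L) else 0)).Local v)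
      (b : (UnitaryGroup.cmDatum L 3 H').Local v)
      (x : (UnitaryGroup.cmDatum L 2 (Matrix.of fun i j : Fin 2 => if i.val + j.val + 1 = 2 then (1 : L) else 0)).Local v ×
      (UnitaryGroup.cmDatum L 1 (Matrix.of fun i j : Fin 1 => if i.val + j.val + 1 = 1 then (1 : L) else 0)).Local v),
      finExplicitDelta L v H' (x * a * x⁻¹) μ b = finExplicitDelta L v H' a μ b)
    (hr : ∀ (v : HeightOneSpectrum (𝓞 ↥(maximalRealSubfield L)))
      (a : (UnitaryGroup.cmDatum L 2 (Matrix.of fun i j : Fin 2 => if i.val + j.val + 1 = 2 then (1 : L) else 0)).Local v ×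
      (UnitaryGroup.cmDatum L 1 (Matrix.of fun i j : Fin 1 => if i.val + j.val + 1 = 1 then (1 : L) else 0)).Local v)
      (b y : (UnitaryGroup.cmDatum L 3 H').Local v),
      finExplicitDelta L v H' a μ (y * b * y⁻¹) = finExplicitDelta L v H' a μ b)
    (hκ : ∀ (γH : (UnitaryGroup.cmDatum L 2 (Matrix.of fun i j : Fin 2 => if i.val + j.val + 1 = 2 then (1 : L) else 0)).Rational ×
        (UnitaryGroup.cmDatum L 1 (Matrix.of fun i j : Fin 1 => if i.val + j.val + 1 = 1 then (1 : L) else 0)).Rational)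
      (γ : (UnitaryGroup.cmDatum L 3 H').Adelic),
      IsGRegular (cmConjRingHom L) (Matrix.of fun i j : Fin 2 => if i.val + j.val + 1 = 2 then (1 : L) else 0)
        (Matrix.of fun i j : Fin 1 => if i.val + j.val + 1 = 1 then (1 : L) else 0)
        (Matrix.of fun i j : Fin 3 => if i.val + j.val + 1 = 3 then (1 : L) else 0) endoForm_antidiagOne γH →
      (∀ v, IsLocalNormPair L H' v (rationalComponent L γH v) ((UnitaryGroup.cmDatum L 3 H').toLocal v γ)) →
      ∀ᶠ v : HeightOneSpectrum (𝓞 ↥(maximalRealSubfield L)) in cofinite,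
        finKappaAt L v H' (rationalComponent L γH v) ((UnitaryGroup.cmDatum L 3 H').toLocal v γ) = 1) :
    IsAlmostEverywhereTrivial L H' (finExplicitCollection L H' μ hl hr) := by
  intro γH γ hreg hmatch
  filter_upwards [eventually_finTau_rationalComponent_eq_one L γH μ hreg, eventually_finWeylRatio_rationalComponent_eq_one L γH hreg,
    hκ γH γ hreg hmatch] with v h1 h2 h3
  have hm : IsLocalNormPair L H' v (rationalComponent L γH v) ((UnitaryGroup.cmDatum L 3 H').toLocal v γ) := hmatch v
  unfold adelicFactorAt
  rw [finExplicitCollection_Δ]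
  change finExplicitDelta L v H' (rationalComponent L γH v) μ ((UnitaryGroup.cmDatum L 3 H').toLocal v γ) = 1
  rw [finExplicitDelta_of_isLocalNormPair L v H' _ μ hm, h1, h2, h3]
  simp

end Reduction

end Literature.NumberTheory.Rogawski1990

end
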